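import Summits.Ventures.PercRepro.Night2GoodTwoD2Main

/-!
# night-2: the column side of `localShadowHall_of_gt2` in cell `(2, 1)`

`dload_gt2_le_cap2` in the exact form of the first hypothesis of `localShadowHall_of_gt2` (`P := bigP`, `dsh := dshGT2`):
at every shadow set `S ∈ shadowAt M 7 5 (Uq M 7 5) G` the `dshGT2` load is at most `cap2 S`, and the local Hall
inequality of the cell follows from the basis pairs' fair share alone (`localShadowHall_of_gt2_of_basis_fair`).
-/

namespace PercRepro.Shadow

open PercRepro.ThmH PercRepro.PerFlat

variable {α : Type*} [DecidableEq α] {M : Matroid α} [M.Finite] {G : Finset α}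

/-- **The column side of `localShadowHall_of_gt2`**: at every shadow set the `dshGT2` load is at most the capacity. -/
theorem column_side_gt2 (hG : G ∈ flatsQ M (5 + 1)) (hd : (gr M \ G).card = 2) (hk : kColoops M G = 1)
    (hs : ∀ e ∈ gr M, ∀ f ∈ gr M, e ≠ f → rkN M {e, f} = 2) (hl : ∀ e ∈ gr M, M.Indep {e})
    (hfat : (fatClosures M 5 G 2).card ≤ 1) :
    ∀ S ∈ shadowAt M (5 + 2) 5 (Uq M (5 + 2) 5) G, dload M 5 G (bigP M G) (dshGT2 M 5 G) S ≤ cap2 M 5 G S :=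
  fun _ hS => dload_gt2_le_cap2 hG hd hk hs hl hfat (subset_G_of_mem_shadowAt hS) (coloops_subset_of_mem_shadowAt hS)

/-- **The local Hall inequality of cell `(2, 1)` (≤ 1 fat closure) from the basis pairs' fair share alone.** -/
theorem localShadowHall_of_gt2_of_basis_fair (hG : G ∈ flatsQ M (5 + 1)) (hd : (gr M \ G).card = 2)
    (hk : kColoops M G = 1) (hs : ∀ e ∈ gr M, ∀ f ∈ gr M, e ≠ f → rkN M {e, f} = 2)
    (hl : ∀ e ∈ gr M, M.Indep {e}) (hfat : (fatClosures M 5 G 2).card ≤ 1)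
    (hfair : ∀ B ∈ thinMembers M 5 G, ¬ bigP M G B → ∀ z ∈ G \ clF M B,
      loss M 5 G B z ≤ rhoL M 5 G B z * lossIncomeH M 5 G (bigP M G) (dshGT2 M 5 G) B z) :
    LocalShadowHall M 5 G :=
  localShadowHall_of_gt2 hG (by omega) (column_side_gt2 hG hd hk hs hl hfat) hfair

end PercRepro.Shadow
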